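import Literature.NumberTheory.EllipticCurves.GreenbergVatsal2000.LocalConditionAtP
import Literature.NumberTheory.EllipticCurves.Greenberg1999.TwoTorsionMuInvariant
import Literature.NumberTheory.EllipticCurves.KummerMap
import HarnessLib

/-!
# Greenberg, *Iwasawa theory for elliptic curves* (LNM 1716, 1999), §5 (pp. 168–176): the line
# `C₂[2] ⊆ E[2]` at a good-ordinary-or-multiplicative `2` is the kernel of reduction — the rational
# point `P` of order `2` lies on `C₂` iff `v₂(x(P)) < 0` (the DICTIONARY behind `TwoTorsionRamifiedAtTwo`)

Topic `NumberTheory/EllipticCurves`, sub-directory `Greenberg1999` (namespace = path). TWO named facts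
(`def … : Prop`, D-0014; nothing asserted), written by the seat `bsd-2adic-t42` of the cell `bsd-2adic`
(HOME `run/shared/lean/pub/bsd-2adic/`, design memo `t42/DESIGN-T42.md`, fact F4): the OBJECT-LEVEL form
of the dictionary already recorded, as a reading flag (`Gre99-C2-kernel-of-reduction`), in the docstring
of `Greenberg1999.TwoTorsionRamifiedAtTwo` (file `TwoTorsionMuInvariant.lean`) and audited there for its
consumers (`prop514_isTorsion_mu_eq_zero_two`, the readings of Matsuno's Thm. 4.2). The kernel transport
`multCongruenceTransportAtTwo_of_print_nonsplit_of_Δ_neg`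
(`Summits/…/Theorems/ByReductionTypeAtTwoMultTransportLambda.lean`) consumes exactly these two
statements (there: hypotheses `hF4T`, `hF4G`).

## The printed statements (PRIMARY, held and read: R. Greenberg, LNM 1716, chunks of
## `book:coatesnd-arithmetic-theory-elliptic-curves`; J. H. Silverman, *AEC* VII.2 and *ATAEC* V.3–V.5)

* §5 p. 168 (chunk p0168): for `E/ℚ` with good ordinary or multiplicative reduction at `2`, "`C₂`
  … characterized by `C₂ ≅ μ_{2^∞}` for the action of `I_{ℚ₂}`"; for a rational point `P` of order
  `2`, `Φ = ⟨P⟩` is "ramified at 2" iff `Φ ⊆ C₂`. At a good ordinary `2`, `C₂ = ker(E[2^∞] → Ẽ[2^∞])`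
  is the `2`-power torsion of the kernel of reduction `E₁` (§2 p. 70); at a multiplicative `2`, `C₂` is
  the image of `μ_{2^∞}` under the Tate parametrisation (p. 75; Silverman *ATAEC* V.3–V.5), again
  contained in — and equal on `2`-power torsion to — the kernel of reduction.
* p. 176 (chunk p0176), the worked example: the point `(0, 0)` "is not in the kernel of reduction
  modulo `2` and so is not in `C₂`"; p. 174 (chunk p0174): `(3/4, −7/8)` "generates `C₂[2]`".
* Silverman *AEC* VII.2 (Prop. 2.1/2.2 and its proof): on a minimal Weierstrass model,
  `E₁(K) = {P ∈ E(K) : v(x(P)) < 0} ∪ {O}` is the kernel of reduction. Silverman *ATAEC* V.3.1 (c)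
  (`X(u, q) = u/(1−u)² + …`): the point of order `2` coming from `u = −1` has `v(x) < 0`, those from
  `u = ±√q` have `v(x) ≥ 0`.

So, for a GLOBALLY MINIMAL `E/ℚ` and a rational point `P = (x, y)` of order `2`:
`P ∈ C₂ ⟺ P ∈ E₁(ℚ₂) ⟺ v₂(x) < 0 ⟺ TwoTorsionRamifiedAtTwo x`.

## Transcription (what the Lean below says)

Both facts are over `ℚ` at `p = 2`, for a globally minimal elliptic `W`, a place `v ∋ 2`, and a
rational point `(x, y)` with `2y + a₁x + a₃ = 0` (order `2`), read in `E(ℚ̄)` (`toGeomPoints`) and then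
in `E(ℚ̄_v)` (`pointsMap`).
* `twoTorsion_mem_tateLine_iff_ramifiedAtTwo` (multiplicative `2`): for every twisted Tate
  parametrisation `(q, t, Ψ)` with the clauses of the tree's `Silverman1994_thmV53_corV54_tateUniformisation`
  (the binders of `imKummer_ge_strictCondition_multiplicative_cyclotomic`), "`P` is `Ψ` of a root of
  unity" (membership in the Tate line `C₂ = Ψ(μ)`, the tree's `tateDatum`) iff `TwoTorsionRamifiedAtTwo x`.
* `twoTorsion_mem_kernelReduction_iff_ramifiedAtTwo` (good `2`): for the reduction map `red₀` of the
  minimal model at a spectral valuation `w` of `ℚ̄_v` (the binders of `imKummer_ge_greenbergCondition_at_p`),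
  `red₀ P = 0` iff `TwoTorsionRamifiedAtTwo x`.
The second is in principle provable from the tree's `reducePoint` API (`reducesToZero_some_iff`:
an affine point reduces to `Õ` iff its abscissa is not `w`-integral); it is recorded as a fact pending
that proof. Weaker than print (`ℚ`, `p = 2`, the rational point only).

## References
* [GreenbergLNM1716] R. Greenberg, *Iwasawa theory for elliptic curves*, LNM 1716 (1999): §2 pp. 70,
  75; §5 pp. 168, 174, 176.
* [SilvermanAEC2009] J. H. Silverman, *The Arithmetic of Elliptic Curves*, VII.2 Props. 2.1–2.2.
* [SilvermanATAEC1994] J. H. Silverman, *Advanced Topics*, V.3 Thm. 3.1 (c), V.5 Thm. 5.3, Cor. 5.4.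
-/

noncomputable section

open scoped Classical NNReal

open NumberField IsDedekindDomain Field WeierstrassCurve
  Literature.NumberTheory.EllipticCurves Literature.NumberTheory.EllipticCurves.GreenbergSelmer
  Literature.NumberTheory.GaloisRepresentations

namespace Literature.NumberTheory.EllipticCurves.Greenberg1999

/-- **Greenberg LNM 1716 §5 (p. 168, with pp. 174/176) + Silverman *ATAEC* V.3.1 (c): at a
multiplicative `2`, the rational point `P = (x, y)` of order `2` lies on the Tate line `C₂ = Ψ(μ)` iff
`v₂(x) < 0`.** Transcription (module docstring): `W/ℚ` globally minimal elliptic, multiplicative at `2`;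
`v ∋ 2`; `(q, t, Ψ)` any twisted Tate parametrisation of `E(ℚ̄_v)` with the clauses of
`Silverman1994_thmV53_corV54_tateUniformisation`; `(x, y)` a rational point with `2y + a₁x + a₃ = 0`;
then `ι(P) ∈ Ψ(roots of unity) ↔ TwoTorsionRamifiedAtTwo x`. Named fact; nothing asserted
(flag `Gre99-C2-kernel-of-reduction`, multiplicative case).
-- TODO(general form): `C₂ ∩ E[2^∞] = E₁[2^∞]` for every `2`-power torsion point, any number field.
[cite: GreenbergLNM1716, §5 p. 168 (C₂ ≅ μ_{2^∞} as I_{ℚ₂}-module; "ramified at 2"), p. 176 ("not in the kernel of reduction modulo 2 and so is not in C₂"), p. 174]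
[cite: SilvermanATAEC1994, Ch. V Thm. 3.1 (c), Thm. 5.3, Cor. 5.4] -/
def twoTorsion_mem_tateLine_iff_ramifiedAtTwo : Prop :=
  ∀ (W : WeierstrassCurve ℚ) [W.IsElliptic] [W.IsGloballyMinimal],
    W.HasMultiplicativeReductionAtPrime 2 →
    ∀ (v : HeightOneSpectrum (𝓞 ℚ)) (_hv : ((2 : ℕ) : 𝓞 ℚ) ∈ v.asIdeal)
      (q : v.adicCompletion ℚ) (t : AlgebraicClosure (v.adicCompletion ℚ))
      (Ψ : Additive (AlgebraicClosure (v.adicCompletion ℚ))ˣ →+ localPoints W (v.adicCompletion ℚ)),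
      q ≠ 0 → Valued.v q < 1 →
      t ^ 2 = algebraMap (v.adicCompletion ℚ) (AlgebraicClosure (v.adicCompletion ℚ))
        (algebraMap ℚ (v.adicCompletion ℚ) (-(W.c₄ / W.c₆))) →
      Function.Surjective Ψ →
      (∀ u : (AlgebraicClosure (v.adicCompletion ℚ))ˣ, Ψ (Additive.ofMul u) = 0 ↔
        ∃ n : ℤ, (u : AlgebraicClosure (v.adicCompletion ℚ)) =
          algebraMap (v.adicCompletion ℚ) (AlgebraicClosure (v.adicCompletion ℚ)) q ^ n) →
      (∀ (σ : absoluteGaloisGroup (v.adicCompletion ℚ))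
          (u : (AlgebraicClosure (v.adicCompletion ℚ))ˣ),
        σ • Ψ (Additive.ofMul u) =
          (if Field.absoluteGaloisGroup.toAlgEquiv (v.adicCompletion ℚ) σ t = t then (1 : ℤ)
            else -1) •
          Ψ (Additive.ofMul (Units.map
            (Field.absoluteGaloisGroup.toAlgEquiv (v.adicCompletion ℚ) σ :
              AlgebraicClosure (v.adicCompletion ℚ) →* AlgebraicClosure (v.adicCompletion ℚ)) u))) →
    ∀ (x y : ℚ) (hxy : W.toAffine.Nonsingular x y), 2 * y + W.a₁ * x + W.a₃ = 0 →
      ((∃ ζ : (AlgebraicClosure (v.adicCompletion ℚ))ˣ, IsOfFinOrder ζ ∧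
          Ψ (Additive.ofMul ζ) = pointsMap W (v.adicCompletion ℚ)
            (toGeomPoints W (.some x y hxy))) ↔ TwoTorsionRamifiedAtTwo x)

/-- **Greenberg LNM 1716 §5 (p. 168, p. 176) + Silverman *AEC* VII.2: at a good `2`, the rational point
`P = (x, y)` of order `2` lies in the kernel of reduction (Greenberg's `C₂ = ker(E[2^∞] → Ẽ)` at a good
ordinary `2`) iff `v₂(x) < 0`.** Transcription (module docstring): `W/ℚ` globally minimal elliptic,
good at `2`; `v ∋ 2`; `w` a spectral valuation of `ℚ̄_v` and `red₀` the reduction map of the minimal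
model over its valuation ring (the binders of `GreenbergVatsal2000.imKummer_ge_greenbergCondition_at_p`);
`(x, y)` a rational point with `2y + a₁x + a₃ = 0`; then `red₀ (ι P) = 0 ↔ TwoTorsionRamifiedAtTwo x`.
Named fact; nothing asserted (flag `Gre99-C2-kernel-of-reduction`, good case; provable in principle from
the tree's `reducesToZero_some_iff`).
-- TODO(general form): every point, any number field (Silverman VII.2: `E₁ = {v(x) < 0}`).
[cite: GreenbergLNM1716, §2 p. 70 and §5 pp. 168, 176] [cite: SilvermanAEC2009, VII.2 Props. 2.1–2.2] -/
def twoTorsion_mem_kernelReduction_iff_ramifiedAtTwo : Prop :=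
  ∀ (W : WeierstrassCurve ℚ) [W.IsElliptic] [W.IsGloballyMinimal],
    W.HasGoodReductionAtPrime 2 →
    ∀ (v : HeightOneSpectrum (𝓞 ℚ)) (_hv : ((2 : ℕ) : 𝓞 ℚ) ∈ v.asIdeal)
      (w : Valuation (AlgebraicClosure (v.adicCompletion ℚ)) ℝ≥0)
      (_hw : ∀ z, (w z : ℝ) =
        spectralNorm (v.adicCompletion ℚ) (AlgebraicClosure (v.adicCompletion ℚ)) z)
      (red₀ : localPoints W (v.adicCompletion ℚ) →+
        (((integralModelInt W).map (algebraMap ℤ ↥w.valuationSubring)).map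
          (IsLocalRing.residue ↥w.valuationSubring)).toAffine.Point)
      (_hred₀ : ∀ P : localPoints W (v.adicCompletion ℚ), red₀ P =
        ((integralModelInt W).map (algebraMap ℤ ↥w.valuationSubring)).reducePoint
          (Affine.Point.congrEquiv (localIntModel_baseChange W w.valuationSubring).symm P))
      (x y : ℚ) (hxy : W.toAffine.Nonsingular x y), 2 * y + W.a₁ * x + W.a₃ = 0 →
      (red₀ (pointsMap W (v.adicCompletion ℚ) (toGeomPoints W (.some x y hxy))) = 0 ↔
        TwoTorsionRamifiedAtTwo x)

end Literature.NumberTheory.EllipticCurves.Greenberg1999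

end
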